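import Mathlib

/-!
# Venture HSemireg — W3 SPECIAL FIBRES, Jacobian centres: the algebraic hearts of the g = 4 rung of Schoen's
# carrier (seat `w3-jac-1` g8, file of record `widen/W3/W3-JAC-1-LOCAL.md` v1.2, §1, §8, §9)

HONEST FRAMING. Lean index of the computation cell `pub-hsemireg`, widening seat `w3-jac-1`.  ELEMENTARY
ALGEBRA AND ARITHMETIC ONLY: no curve, no Prym variety, no Hodge structure, no normal bundle and no
semiregularity map is constructed here.  On paper (LOCAL §8.1, THEOREM ISO) the Hermitian form
`⟨[X_t], ω ∧ ω̄'⟩` on `H^{d,0}(P)` has, on the two extreme `K`-blocks, the matrix `[[a, m̄], [m, a]]` with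
`a = a_r · d! · μ^d · ν₀` and `|m| = ρ · ν₀`, where the three normalisations of ALB §C4 read
`a_r · (3 · d!) = 1`, `μ^{2d} · ν₀ = 3^d`, `ρ² · ν₀ = 3^{d−2}`; `iso_corner_identity` says these force
`a² = |m|²`, and `corner_det_zero` that such a block has determinant zero (the one holomorphic `d`-form of `P`
dying on the carrier).  On paper (LOCAL §1.3, PROP. AP-RIGID) the identity `dψ(κ) = ψ*v` splits along three
`σ`-characters; `character_trichotomy` is the bookkeeping step «components in a direct sum are equal
separately».  On paper (LOCAL §8.3–8.5, THEOREMS Q4 / SR4 / DEF4 at g = 4) the numbers are: Castelnuovo–de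
Franchis `p_g ≥ 2q − 3` with `p_g = q + 1` and `q ≥ 4` forces `q = 4` (`castelnuovo_de_franchis_squeeze`);
the fibration bounds `K² = 16 ≥ 8(b−1)(g−1)`, `e = 8 ≥ 4(b−1)(g−1)` leave `(b−1)(g−1) ∈ {1, 2}`
(`fibration_cases`); `b₂ = e − 2 + 2b₁ = 22`, `h^{1,1} = b₂ − 2p_g = 12`, `χ(T) = (7K² − 5e)/6 = 12 = 10 + 2`,
`h¹(T) = 16 − 12 = 4`, `h²(T) = 20 − 4 = 16` (`g4_numbers`); and the exclusion of an isogeny matching the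
Schoen-surface class (`16λ² = 36 ∧ 24λ⁴ = 216n` resp. `36λ² = 16 ∧ 216λ⁴ = 24n` have no solution with `n ∈ ℕ`:
`no_isogeny_to_schoen_class`, `no_isogeny_from_schoen_class`).  `r3_smoothness_patterns` records the degree
bound `Σ (m − ⌈m/3⌉) ≤ 2` over the five multiplicity patterns of a degree-4 divisor (LOCAL §9.1 (iii)), and
`weil_frame_values` the frame normalisations for `d = 1, …, 4` reproduced by `jac1/lag/cup_rank.py`.
Nothing here says that HC, HC_CM or HC_AV holds, that any object is semiregular, or that the hypotheses of
LOCAL §8 (the class formula of ALB §C4, simplicity of the general Prym, the exact rank 12) are met.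

CONTENT (all PROVED, 0 sorry), namespace `Summit.Ventures.HSemireg.SchoenCarrierLagrangian`.
-/

namespace Summit.Ventures.HSemireg.SchoenCarrierLagrangian

/-- LOCAL §8.1 (THEOREM ISO), the corner identity: with `ad := a_r · d!`, `m := μ^{2d}`, `r2 := ρ²` and
`ν := ν₀`, the normalisations `a_r(3·d!) = 1`, `μ^{2d}ν₀ = 3^d`, `9ρ²ν₀ = 3^d` give
`(a_r d!)² μ^{2d} ν₀² = ρ² ν₀²`, i.e. `a · c = |m|²` for the extreme 2 × 2 block. -/
theorem iso_corner_identity (d : ℕ) (ad m r2 ν : ℝ)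
    (h1 : ad * 3 = 1) (h2 : m * ν = 3 ^ d) (h3 : r2 * ν * 9 = 3 ^ d) :
    ad ^ 2 * m * ν ^ 2 = r2 * ν ^ 2 := by
  linear_combination ((ad + 1 / 3) / 3 * m * ν ^ 2) * h1 + (ν / 9) * h2 - (ν / 9) * h3

/-- LOCAL §8.1: a Hermitian corner `[[a, m̄], [m, a]]` with `|m|² = a²` is singular:
`a·a − m·m̄ = 0` in `ℂ`. -/
theorem corner_det_zero (a : ℝ) (m : ℂ) (h : Complex.normSq m = a ^ 2) :
    (a : ℂ) * a - m * (starRingEnd ℂ) m = 0 := by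
  rw [Complex.mul_conj, h]
  push_cast
  ring

/-- LOCAL §1.3 (PROP. AP-RIGID), the bookkeeping step: if linear maps `κ₀ : V → W₁`, `κ₁ : V → W₂`,
`κ₂ : V → W₀` (the three character components of a curve deformation acting on `χ`-forms) and `v : V → W₁`
(a `K`-equivariant deformation of the Prym) satisfy `(κ₂ x, κ₀ x, κ₁ x) = (0, v x, 0)` in `W₀ × W₁ × W₂`
for all `x`, then `κ₁ = 0`, `κ₂ = 0` and `κ₀ = v`. -/
theorem character_trichotomy {R V W₀ W₁ W₂ : Type*} [CommRing R]
    [AddCommGroup V] [Module R V] [AddCommGroup W₀] [Module R W₀]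
    [AddCommGroup W₁] [Module R W₁] [AddCommGroup W₂] [Module R W₂]
    (κ₀ : V →ₗ[R] W₁) (κ₁ : V →ₗ[R] W₂) (κ₂ : V →ₗ[R] W₀) (v : V →ₗ[R] W₁)
    (h : ∀ x : V, ((κ₂ x, κ₀ x), κ₁ x) = (((0 : W₀), v x), (0 : W₂))) :
    κ₁ = 0 ∧ κ₂ = 0 ∧ κ₀ = v := by
  refine ⟨?_, ?_, ?_⟩
  · ext x
    have hx := h x
    simp only [Prod.mk.injEq] at hx
    simpa using hx.2
  · ext x
    have hx := h x
    simp only [Prod.mk.injEq] at hx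
    simpa using hx.1.1
  · ext x
    have hx := h x
    simp only [Prod.mk.injEq] at hx
    exact hx.1.2

/-- LOCAL §8.3 (THEOREM Q4): with `p_g = q + 1` (from `χ(𝒪) = 2`), `q ≥ 4` (the Prym injects into `H¹(𝒪)`)
and Castelnuovo–de Franchis `p_g ≥ 2q − 3` (no irrational pencil), `q = 4` and `p_g = 5`. -/
theorem castelnuovo_de_franchis_squeeze (q pg : ℕ) (hchi : pg = q + 1) (hq : 4 ≤ q)
    (hcdf : 2 * q ≤ pg + 3) : q = 4 ∧ pg = 5 := by
  omega

/-- LOCAL §8.3 (THEOREM Q4), the fibration bounds: for a genus-`g` fibration over a genus-`b` curve,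
`b, g ≥ 2`, with `K² = 16 ≥ 8(b−1)(g−1)` and `e = 8 ≥ 4(b−1)(g−1)`, only `(b−1)(g−1) ∈ {1, 2}` remain,
i.e. `(b, g) ∈ {(2,2), (2,3), (3,2)}`. -/
theorem fibration_cases (b g : ℕ) (hb : 2 ≤ b) (hg : 2 ≤ g)
    (hK : 8 * ((b - 1) * (g - 1)) ≤ 16) :
    (b = 2 ∧ g = 2) ∨ (b = 2 ∧ g = 3) ∨ (b = 3 ∧ g = 2) := by
  have h1 : (b - 1) * (g - 1) ≤ 2 := by omega
  have hb1 : 1 ≤ b - 1 := by omega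
  have hg1 : 1 ≤ g - 1 := by omega
  have hb2 : b - 1 ≤ 2 := by
    calc b - 1 = (b - 1) * 1 := by ring
      _ ≤ (b - 1) * (g - 1) := Nat.mul_le_mul_left _ hg1
      _ ≤ 2 := h1
  have hg2 : g - 1 ≤ 2 := by
    calc g - 1 = 1 * (g - 1) := by ring
      _ ≤ (b - 1) * (g - 1) := Nat.mul_le_mul_right _ hb1
      _ ≤ 2 := h1
  have hb3 : b ≤ 3 := by omega
  have hg3 : g ≤ 3 := by omega
  interval_cases b <;> interval_cases g <;> omega

/-- LOCAL §8.4–8.5 (THEOREMS SR4, DEF4), the g = 4 numerology of the minimal carrier `X_t`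
(`K² = 16`, `e = 8`, `q = 4`, `p_g = 5`): `b₂ = e − 2 + 2b₁ = 22`, `h^{1,1} = b₂ − 2p_g = 12`
(`= h¹(N)` for the Lagrangian surface), `χ(T_{X_t}) = (7K² − 5e)/6 = 12 = χ(T_{X̃_t}) + 2 = 10 + 2`,
`h¹(T) = 16 − 12 = 4 = dim T_S`, `h²(T) = 4·p_g − h²(N) = 20 − 4 = 16`, and `h² − h¹ = χ(T)`. -/
theorem g4_numbers :
    (8 - 2 + 2 * 8 : ℤ) = 22 ∧ (22 - 2 * 5 : ℤ) = 12 ∧ (7 * 16 - 5 * 8 : ℤ) / 6 = 12 ∧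
    (7 * 16 - 5 * 8 : ℤ) = 6 * 12 ∧ (12 : ℤ) = 10 + 2 ∧ (16 - 12 : ℤ) = 4 ∧ (4 * 5 - 4 : ℤ) = 16 ∧
    (16 - 4 : ℤ) = 12 ∧ (7 * 15 - 5 * 9 : ℤ) = 6 * 10 := by
  norm_num

/-- LOCAL §8.3 (COROLLARY), first direction: an isogeny of degree `n` from the Albanese of a Schoen surface
(`Θ² · [S] = 16`, `Θ⁴ = 24`) to `P` (`Ξ² · [X_t] = 36`, `Ξ⁴ = 216`) with `φ*Ξ = λΘ`, `l2 := λ²`, would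
need `16 λ² = 36` and `24 λ⁴ = 216 n` — impossible for `n ∈ ℕ`. -/
theorem no_isogeny_to_schoen_class (n : ℕ) (l2 : ℚ) (h1 : 16 * l2 = 36)
    (h2 : 24 * l2 ^ 2 = 216 * n) : False := by
  have hl : l2 = 9 / 4 := by linarith
  subst hl
  have h3 : (432 * n : ℚ) = 243 := by linarith
  have h4 : 432 * n = 243 := by exact_mod_cast h3
  omega

/-- LOCAL §8.3 (COROLLARY), second direction: an isogeny of degree `n` from `P` to the Albanese of a Schoen
surface with `ψ*Θ = λΞ` would need `36 λ² = 16` and `216 λ⁴ = 24 n` — impossible for `n ∈ ℕ`. -/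
theorem no_isogeny_from_schoen_class (n : ℕ) (l2 : ℚ) (h1 : 36 * l2 = 16)
    (h2 : 216 * l2 ^ 2 = 24 * n) : False := by
  have hl : l2 = 4 / 9 := by linarith
  subst hl
  have h3 : (72 * n : ℚ) = 128 := by linarith
  have h4 : 72 * n = 128 := by exact_mod_cast h3
  omega

/-- LOCAL §9.1 (iii): for a degree-4 (canonical, genus 3) divisor the even three-sheet spread leaves
`Σ (m − ⌈m/3⌉) ≤ 2` in each of the five multiplicity patterns `(4), (3,1), (2,2), (2,1,1), (1,1,1,1)`
(`⌈m/3⌉ = (m + 2)/3` in `ℕ`); `2 < 3 = gonality` of a non-hyperelliptic genus-3 curve. -/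
theorem r3_smoothness_patterns :
    (4 - (4 + 2) / 3 = 2) ∧ (3 - (3 + 2) / 3 + (1 - (1 + 2) / 3) = 2) ∧
    (2 - (2 + 2) / 3 + (2 - (2 + 2) / 3) = 2) ∧ (2 - (2 + 2) / 3 + 2 * (1 - (1 + 2) / 3) = 1) ∧
    (4 * (1 - (1 + 2) / 3) = 0) := by
  decide

/-- LOCAL §8.0/§8.1, the frame normalisations reproduced by `jac1/lag/cup_rank.py` for `d = 1, 2, 3, 4`:
`Ξ^{2d} = (2d)!·3^d = 6, 216, 19440, 3265920`; `dim H^{d,0} − 1 = C(2d,d) − 1 = 1, 5, 19, 69`;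
`[X_t]² = 3^{d−2}(C(2d,d) + 2(−1)^d)` for `d = 2, 3, 4` is `8, 54, 648` and `[X_t]·Ξ^d = 2d·…`:
`∫ x^{d−1}θ_P = 2d·3^{d−1} = 12, 54, 216, 810, 2916` for `d = 2, …, 6` (LEMMA Γ). -/
theorem weil_frame_values :
    (Nat.factorial 2 * 3 ^ 1 = 6 ∧ Nat.factorial 4 * 3 ^ 2 = 216 ∧ Nat.factorial 6 * 3 ^ 3 = 19440 ∧
      Nat.factorial 8 * 3 ^ 4 = 3265920) ∧
    (Nat.choose 2 1 - 1 = 1 ∧ Nat.choose 4 2 - 1 = 5 ∧ Nat.choose 6 3 - 1 = 19 ∧ Nat.choose 8 4 - 1 = 69) ∧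
    (3 ^ 0 * (Nat.choose 4 2 + 2) = 8 ∧ 3 ^ 1 * (Nat.choose 6 3 - 2) = 54 ∧
      3 ^ 2 * (Nat.choose 8 4 + 2) = 648) ∧
    (2 * 2 * 3 ^ 1 = 12 ∧ 2 * 3 * 3 ^ 2 = 54 ∧ 2 * 4 * 3 ^ 3 = 216 ∧ 2 * 5 * 3 ^ 4 = 810 ∧
      2 * 6 * 3 ^ 5 = 2916) := by
  decide

end Summit.Ventures.HSemireg.SchoenCarrierLagrangian
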